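import Literature.NumberTheory.Transcendental.KaehlerLefschetzOperatorProofs
import Literature.Geometry.Kaehler.KaehlerSymbolIdentityOpProofs

/-!
# The operator `P = [∂̄*, L] - i∂` is `C^∞`-linear (Voisin, Lemma 6.6: `[∂̄*, L]` has order zero)

On a complex manifold `M` (charts in the finite-dimensional complex normed space `E`, holomorphic
transition maps) with a `C^∞` Riemannian metric on the real tangent bundle which is Hermitian for
the complex structure `J`, consider on smooth complex forms the operator

  `P β = ∂̄*(L β) - L (∂̄* β) - i ∂β`     (positive degree),   `P₀ f = ∂̄*(L f) - i ∂f`   (functions),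

where `L = ω ∧ ·` is the Lefschetz operator of the metric (`KaehlerLefschetzOperatorProofs.lean`;
family `G x = gₓ` of bilinear forms on the model space) and `∂̄* = -⋆∂⋆`. The Kähler identity
`[∂̄*, L] = i∂` (Voisin (2002), Lemma 6.6, the `L`-form of Prop. 6.5) says `P = 0`. This file
proves the first half of Voisin's argument: **`P` is `C^∞`-linear**, `P(ρ β) x = ρ x • P(β) x`
for every real function `ρ` differentiable at `x` (`kaehlerP_fun_smul`, `kaehlerP_fun_smul_zero`):
the first-order parts of the three Leibniz rules (`∂̄*(ρ γ) = ρ ∂̄*γ - ⋆(∂ρ ∧ ⋆γ)` twice and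
`∂(ρ β) = ρ ∂β + ∂ρ ∧ β`) cancel by the pointwise symbol identity
`-⋆(ξ ∧ ⋆(Lβ)) + L(⋆(ξ ∧ ⋆β)) - i ξ ∧ β = 0` for `ξ = (dρ)^{1,0}`
(`symbol_dolbeaultBarAdjoint_lefschetz_sub_of`, here specialised to a point of `M` as
`symbol_identity_pt`). Voisin (2002), §6.1.1, proof of Lemma 6.6 (p. 140: on `ℂⁿ` with the flat
metric `[∂̄*, L] = i∂` is checked on forms with constant coefficients after noting that both sides
are first-order operators with the same symbol); Huybrechts (2005), Prop. 3.1.12.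

The second half (vanishing of `P` at a point on suitable test forms osculating the flat case, via
Voisin's Prop. 3.14) is not in this file.

## References

* C. Voisin, *Hodge Theory and Complex Algebraic Geometry I* (2002), §6.1.1, Prop. 6.5, Lemma 6.6.
  [Voisin2002]
* D. Huybrechts, *Complex Geometry* (2005), Prop. 1.2.26, Prop. 3.1.12. [Huybrechts2005]
-/

noncomputable section

open scoped Manifold ContDiff Topology RealInnerProductSpace
open Set Finset ContinuousAlternatingMap Function Complex Bundle Module
open Literature.LinearAlgebra.Alternating Literature.Analysis.Complex
open Literature.Geometry.Kaehler

namespace Literature.NumberTheory.Transcendental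

set_option quotPrecheck false

set_option hygiene false in
/-- The covector family `θ_B v = ½ B(i v, ·)` of a real bilinear form `B` on the model space. -/
local notation "θE[" B "]" => (2⁻¹ : ℝ) • ContinuousLinearMap.comp B
  ((Complex.I • ContinuousLinearMap.id ℂ E).restrictScalars ℝ)

set_option hygiene false in
/-- The canonical family `v ↦ θ_B v ∧ η` of the model Lefschetz operator. -/
local notation "LfamE[" B "]" η:max =>
  ContinuousLinearMap.comp (ContinuousAlternatingMap.alternatizeUncurryFinCLM ℝ E ℂ)
    (ContinuousLinearMap.comp (ContinuousLinearMap.flip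
      (ContinuousLinearMap.smulRightL ℝ E (E [⋀^Fin _]→L[ℝ] ℂ)) η) (θE[B]))

set_option hygiene false in
/-- The model Lefschetz operator `L_B η` (as in `KaehlerLefschetzOperatorProofs.lean`). -/
local notation "LopE[" B "]" η:max =>
  ContinuousAlternatingMap.alternatizeUncurryFin (𝕜 := ℝ) (E := E) (F := ℂ) (LfamE[B] η)

set_option hygiene false in
/-- The Lefschetz operator of the family `G` on forms on `M` (as in
`KaehlerLefschetzOperatorProofs.lean`). -/
local notation "Lform[" G "]" β:max =>
  @id (MForm 𝓘(ℝ, E) M ℂ (_ + 1 + 1)) (fun x ↦ (LopE[G x] (β x) :))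

/-- The complexified Hodge star at a point (pointwise value of `MForm.cHodgeStar`). -/
local notation "⋆ℂ[" o ", " h "]" η:max =>
  ContinuousLinearMap.compContinuousAlternatingMap Complex.ofRealCLM
      (hodgeStar o h (ContinuousLinearMap.compContinuousAlternatingMap Complex.reCLM η)) +
    Complex.I • ContinuousLinearMap.compContinuousAlternatingMap Complex.ofRealCLM
      (hodgeStar o h (ContinuousLinearMap.compContinuousAlternatingMap Complex.imCLM η))

set_option hygiene false in
/-- The `(1,0)`-part `a^{1,0} = ½ (a ⊗ 1 - i (a ∘ i) ⊗ 1)` of a real covector `a`. -/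
local notation "π₁₀[" a "]" => (2⁻¹ : ℂ) • (ContinuousLinearMap.comp Complex.ofRealCLM a -
  Complex.I • ContinuousLinearMap.comp Complex.ofRealCLM
    (ContinuousLinearMap.comp a ((Complex.I • ContinuousLinearMap.id ℂ E).restrictScalars ℝ)))

set_option hygiene false in
/-- The chart differential `dρₓ = D(ρ ∘ e⁻¹)(e x)` of a real function at `x`. -/
local notation "dρ[" ρ ", " x "]" => fderivWithin ℝ (ρ ∘ (extChartAt 𝓘(ℝ, E) x).symm)
  (Set.range 𝓘(ℝ, E)) (extChartAt 𝓘(ℝ, E) x x)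

section CinftyLinear

variable {E : Type*} [NormedAddCommGroup E] [NormedSpace ℂ E]
  {M : Type*} [TopologicalSpace M] [ChartedSpace E M] {k : ℕ}
  [FiniteDimensional ℂ E] {n : ℕ} [Fact (finrank ℝ E = n)]
  [RiemannianBundle (fun x : M ↦ TangentSpace 𝓘(ℝ, E) x)]
  (o : (x : M) → Orientation ℝ (TangentSpace 𝓘(ℝ, E) x) (Fin n))

/-- Rearrangement `-a + b - c = 0 → a + c = b`. [folklore] -/
theorem add_eq_of_neg_add_sub_eq_zero {α : Type*} [AddCommGroup α] {a b c : α}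
    (h : -a + b - c = 0) : a + c = b := by
  rw [sub_eq_zero] at h
  rw [← h]
  abel

/-- Rearrangement `-a - c = 0 → a + c = 0`. [folklore] -/
theorem add_eq_zero_of_neg_sub_eq_zero {α : Type*} [AddCommGroup α] {a c : α}
    (h : -a - c = 0) : a + c = 0 := by
  rw [← neg_add', neg_eq_zero] at h
  exact h

/-- **Voisin's Lemma 6.6 at a point of the manifold** (positive degree). At `x ∈ M`, for the metric
`G = gₓ` (Hermitian for the complex structure `J`, `hH`), an orientation `o x`, a complex covector
`ξ` of type `(1,0)` and a complex `(k+1)`-form `β` on `T_x M`: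
`⋆(ξ ∧ ⋆(L β)) + i (ξ ∧ β) = L (⋆(ξ ∧ ⋆β))` — the symbol of `[∂̄*, L] - i∂` vanishes
(`symbol_dolbeaultBarAdjoint_lefschetz_sub_of` on `V = T_x M`, with the Lefschetz operator written in
model-space types; the commutation rule `[ι_w, L] = (ι_w ω) ∧` is `curryLeft_lef_eq`).
[cite: Voisin2002, §6.1.1 Lemma 6.6, p. 140] -/
theorem symbol_identity_pt (x : M) (hn : Even n)
    (hH : ∀ v w : TangentSpace 𝓘(ℝ, E) x, ⟪tangentJ E x v, tangentJ E x w⟫ = ⟪v, w⟫)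
    (G : E →L[ℝ] E →L[ℝ] ℝ) (hG : ∀ v w : TangentSpace 𝓘(ℝ, E) x, G v w = ⟪v, w⟫)
    (ξ : E →L[ℝ] ℂ) (hξ : ∀ v : E, ξ (I • v) = I * ξ v) {m₁ m₃ : ℕ}
    (h₁ : (k + 1 + 1 + 1) + m₁ = n) (h₂ : (m₁ + 1) + (k + 1 + 1) = n) (h₃ : (k + 1) + m₃ = n)
    (h₄ : (m₃ + 1) + k = n) (β : E [⋀^Fin (k + 1)]→L[ℝ] ℂ) :
    ⋆ℂ[o x, h₂] (wedgeOne (E := TangentSpace 𝓘(ℝ, E) x) ξ (⋆ℂ[o x, h₁] (LopE[G] β))) +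
        I • wedgeOne (E := TangentSpace 𝓘(ℝ, E) x) ξ β =
      LopE[G] (⋆ℂ[o x, h₄] (wedgeOne (E := TangentSpace 𝓘(ℝ, E) x) ξ (⋆ℂ[o x, h₃] β))) := by
  have hJ : ∀ u v : TangentSpace 𝓘(ℝ, E) x, ⟪tangentJ E x u, v⟫ = -⟪u, tangentJ E x v⟫ := by
    intro u v
    have := hH u (tangentJ E x v)
    rw [tangentJ_tangentJ, inner_neg_right] at this
    linarith
  have hθ : ∀ w u : TangentSpace 𝓘(ℝ, E) x, (θE[G]) w u = 2⁻¹ * ⟪tangentJ E x w, u⟫ := by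
    intro w u
    rw [← hG]
    rfl
  have h4 := symbol_dolbeaultBarAdjoint_lefschetz_sub_of (V := TangentSpace 𝓘(ℝ, E) x) (o x) hn
    (tangentJ E x) hJ ξ (fun v ↦ hξ v) (θE[G]) hθ h₁ h₂ h₃ h₄
    (fun η ↦ (LopE[G] η :)) (fun η ↦ (LopE[G] η :))
    (fun η η' ↦ lopE_add (E := E) G η η') (fun η ↦ lopE_smul (E := E) G I η) ?_ β
  · exact add_eq_of_neg_add_sub_eq_zero h4
  · intro η w
    have h := curryLeft_lefschetz_eq (θE[G]) η w _ (lfamE_apply G η) _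
      (lfamE_apply G (η.curryLeft w))
    rw [← wedgeOne_tangentSpace x] at h
    exact h

/-- **Voisin's Lemma 6.6 at a point of the manifold, degree `0`**:
`⋆(ξ ∧ ⋆(L β)) + i (ξ ∧ β) = 0` for a `0`-form `β`. [cite: Voisin2002, §6.1.1 Lemma 6.6, p. 140] -/
theorem symbol_identity_pt_zero (x : M) (hn : Even n)
    (hH : ∀ v w : TangentSpace 𝓘(ℝ, E) x, ⟪tangentJ E x v, tangentJ E x w⟫ = ⟪v, w⟫)
    (G : E →L[ℝ] E →L[ℝ] ℝ) (hG : ∀ v w : TangentSpace 𝓘(ℝ, E) x, G v w = ⟪v, w⟫)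
    (ξ : E →L[ℝ] ℂ) (hξ : ∀ v : E, ξ (I • v) = I * ξ v) {m₁ : ℕ}
    (h₁ : (0 + 1 + 1) + m₁ = n) (h₂ : (m₁ + 1) + (0 + 1) = n) (β : E [⋀^Fin 0]→L[ℝ] ℂ) :
    ⋆ℂ[o x, h₂] (wedgeOne (E := TangentSpace 𝓘(ℝ, E) x) ξ (⋆ℂ[o x, h₁] (LopE[G] β))) +
        I • wedgeOne (E := TangentSpace 𝓘(ℝ, E) x) ξ β = 0 := by
  have hJ : ∀ u v : TangentSpace 𝓘(ℝ, E) x, ⟪tangentJ E x u, v⟫ = -⟪u, tangentJ E x v⟫ := by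
    intro u v
    have := hH u (tangentJ E x v)
    rw [tangentJ_tangentJ, inner_neg_right] at this
    linarith
  have hθ : ∀ w u : TangentSpace 𝓘(ℝ, E) x, (θE[G]) w u = 2⁻¹ * ⟪tangentJ E x w, u⟫ := by
    intro w u
    rw [← hG]
    rfl
  have h4 := symbol_dolbeaultBarAdjoint_lefschetz_zero_of (V := TangentSpace 𝓘(ℝ, E) x) (o x) hn
    (tangentJ E x) hJ ξ (fun v ↦ hξ v) (θE[G]) hθ h₁ h₂ (fun η ↦ (LopE[G] η :)) ?_ β
  · exact add_eq_zero_of_neg_sub_eq_zero h4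
  · intro η w
    have h := curryLeft_lefschetz_zero (θE[G]) η w _ (lfamE_apply G η)
    rw [← wedgeOne_tangentSpace x] at h
    exact h

omit [FiniteDimensional ℂ E] in
/-- The `(1,0)`-part of a real covector is of type `(1,0)`: `a^{1,0}(i v) = i a^{1,0}(v)`.
[cite: Voisin2002, §2.3.1] -/
theorem π₁₀_I_smul (a : E →L[ℝ] ℝ) (v : E) : (π₁₀[a]) (I • v) = I * (π₁₀[a]) v :=
  half_sub_I_comp_J_apply_smul a I v

/-- Module algebra behind `P(ρβ) = ρ P(β)`: if `A' = ρA - S₁`, `LB' = ρ LB - LS₂`,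
`C' = ρ C + W` and `S₁ + i W = L S₂` then `A' - LB' - i C' = ρ (A - LB - i C)`. [folklore] -/
theorem kaehlerP_algebra {V : Type*} [AddCommGroup V] [Module ℂ V] [Module ℝ V]
    [SMulCommClass ℂ ℝ V] (r : ℝ) {A' A LB' LB C' C S₁ LS₂ W : V} (hA : A' = r • A - S₁)
    (hB : LB' = r • LB - LS₂) (hC : C' = r • C + W) (hS : S₁ + I • W = LS₂) :
    A' - LB' - I • C' = r • (A - LB - I • C) := by
  subst hA hB hC
  rw [← hS, smul_add, smul_sub, smul_sub, smul_comm I r C]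
  abel

/-- Module algebra behind `P(ρβ) = ρ P(β)` in degree `0`: if `A' = ρA - S₁`, `C' = ρ C + W` and
`S₁ + i W = 0` then `A' - i C' = ρ (A - i C)`. [folklore] -/
theorem kaehlerP_algebra_zero {V : Type*} [AddCommGroup V] [Module ℂ V] [Module ℝ V]
    [SMulCommClass ℂ ℝ V] (r : ℝ) {A' A C' C S₁ W : V} (hA : A' = r • A - S₁)
    (hC : C' = r • C + W) (hS : S₁ + I • W = 0) : A' - I • C' = r • (A - I • C) := by
  subst hA hC
  have hS' : S₁ = -(I • W) := eq_neg_of_add_eq_zero_left hS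
  rw [hS', smul_add, smul_sub, smul_comm I r C]
  abel

variable [IsManifold 𝓘(ℝ, E) ∞ M] [IsManifold 𝓘(ℂ, E) ω M]
  [IsContMDiffRiemannianBundle 𝓘(ℝ, E) ∞ E (fun x : M ↦ TangentSpace 𝓘(ℝ, E) x)]

set_option maxHeartbeats 1600000 in
/-- **The operator `P = [∂̄*, L] - i∂` is `C^∞`-linear** (positive degree). On a complex manifold
with a smooth Hermitian metric (`G x = gₓ`, `hH`), an orientation family with smooth volume form,
for `β` a smooth complex `(k+1)`-form and `ρ` a real function differentiable at `x`:
`P(ρ β) x = ρ x • P(β) x` where `P β = ∂̄*(L β) - L (∂̄* β) - i ∂β`. The three Leibniz rules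
(`dolbeaultBarAdjoint_fun_smul_apply` twice, `dolbeault_fun_smul_sub`) leave exactly the symbol
terms, which cancel by Lemma 6.6 at the point (`symbol_identity_pt`). Voisin (2002), §6.1.1,
proof of Lemma 6.6 / Prop. 6.5 ("`[Λ, ∂̄] + i∂*` is of order `0`"). [cite: Voisin2002, §6.1.1 Lemma 6.6] -/
theorem kaehlerP_fun_smul
    (hH : ∀ (x : M) (v w : TangentSpace 𝓘(ℝ, E) x), ⟪tangentJ E x v, tangentJ E x w⟫ = ⟪v, w⟫)
    (G : M → E →L[ℝ] E →L[ℝ] ℝ) (hG : ∀ (x : M) (v w : TangentSpace 𝓘(ℝ, E) x), G x v w = ⟪v, w⟫)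
    (ho : IsSmoothForm (riemannianVolumeForm o)) {m₁ m₃ : ℕ} (h₁ : (k + 1 + 1 + 1) + m₁ = n)
    (h₃ : (k + 1) + m₃ = n) {ρ : M → ℝ} {β : MForm 𝓘(ℝ, E) M ℂ (k + 1)} {x : M}
    (hρ : MDifferentiableAt 𝓘(ℝ, E) 𝓘(ℝ, ℝ) ρ x) (hβ : IsSmoothForm β) :
    (dolbeaultBarAdjoint o h₁ (Lform[G] (ρ • β)) - Lform[G] (dolbeaultBarAdjoint o h₃ (ρ • β)) -
        I • dolbeault (ρ • β)) x =
      ρ x • (dolbeaultBarAdjoint o h₁ (Lform[G] β) - Lform[G] (dolbeaultBarAdjoint o h₃ β) -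
        I • dolbeault β) x := by
  have hn : Even n := (Fact.out : finrank ℝ E = n) ▸ even_finrank_real E
  have h₂ : (m₁ + 1) + (k + 1 + 1) = n := by omega
  have h₄ : (m₃ + 1) + k = n := by omega
  have hLβ : IsSmoothForm (Lform[G] β) := isSmoothForm_lform G hG hβ
  -- the three Leibniz rules
  have eA : dolbeaultBarAdjoint o h₁ (Lform[G] (ρ • β)) x =
      ρ x • dolbeaultBarAdjoint o h₁ (Lform[G] β) x -
        ⋆ℂ[o x, h₂] (wedgeOne (E := TangentSpace 𝓘(ℝ, E) x) (π₁₀[dρ[ρ, x]])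
          (⋆ℂ[o x, h₁] ((Lform[G] β) x))) := by
    rw [lform_fun_smul]
    exact dolbeaultBarAdjoint_fun_smul_apply o ho h₁ h₂ hρ hLβ
  rw [lform_apply] at eA
  have eB : LopE[G x] (dolbeaultBarAdjoint o h₃ (ρ • β) x) =
      ρ x • LopE[G x] (dolbeaultBarAdjoint o h₃ β x) -
        LopE[G x] (⋆ℂ[o x, h₄] (wedgeOne (E := TangentSpace 𝓘(ℝ, E) x) (π₁₀[dρ[ρ, x]])
          (⋆ℂ[o x, h₃] (β x)))) := by
    rw [dolbeaultBarAdjoint_fun_smul_apply o ho h₃ h₄ hρ hβ, lopT_sub, lopT_real_smul]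
  have eC := eq_add_of_sub_eq' (dolbeault_fun_smul_sub (x := x) hρ hβ)
  rw [← wedgeOne_tangentSpace x] at eC
  -- Lemma 6.6 at `x`
  have hS := symbol_identity_pt o x hn (hH x) (G x) (hG x) (π₁₀[dρ[ρ, x]])
    (π₁₀_I_smul (dρ[ρ, x])) h₁ h₂ h₃ h₄ (β x)
  rewrite [Pi.sub_apply, Pi.sub_apply, Pi.smul_apply, Pi.sub_apply, Pi.sub_apply, Pi.smul_apply,
    lform_apply, lform_apply]
  exact kaehlerP_algebra (ρ x) eA eB eC hS

/-- **The operator `P₀ = ∂̄* L - i∂` on functions is `C^∞`-linear** (degree `0`, where `∂̄*` of a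
function is not defined and `P₀ f = ∂̄*(f ω) - i ∂f`): `P₀(ρ β) x = ρ x • P₀(β) x`.
[cite: Voisin2002, §6.1.1 Lemma 6.6] -/
theorem kaehlerP_fun_smul_zero
    (hH : ∀ (x : M) (v w : TangentSpace 𝓘(ℝ, E) x), ⟪tangentJ E x v, tangentJ E x w⟫ = ⟪v, w⟫)
    (G : M → E →L[ℝ] E →L[ℝ] ℝ) (hG : ∀ (x : M) (v w : TangentSpace 𝓘(ℝ, E) x), G x v w = ⟪v, w⟫)
    (ho : IsSmoothForm (riemannianVolumeForm o)) {m₁ : ℕ} (h₁ : (0 + 1 + 1) + m₁ = n)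
    {ρ : M → ℝ} {β : MForm 𝓘(ℝ, E) M ℂ 0} {x : M}
    (hρ : MDifferentiableAt 𝓘(ℝ, E) 𝓘(ℝ, ℝ) ρ x) (hβ : IsSmoothForm β) :
    (dolbeaultBarAdjoint o h₁ (Lform[G] (ρ • β)) - I • dolbeault (ρ • β)) x =
      ρ x • (dolbeaultBarAdjoint o h₁ (Lform[G] β) - I • dolbeault β) x := by
  have hn : Even n := (Fact.out : finrank ℝ E = n) ▸ even_finrank_real E
  have h₂ : (m₁ + 1) + (0 + 1) = n := by omega
  have hLβ : IsSmoothForm (Lform[G] β) := isSmoothForm_lform G hG hβ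
  have eA : dolbeaultBarAdjoint o h₁ (Lform[G] (ρ • β)) x =
      ρ x • dolbeaultBarAdjoint o h₁ (Lform[G] β) x -
        ⋆ℂ[o x, h₂] (wedgeOne (E := TangentSpace 𝓘(ℝ, E) x) (π₁₀[dρ[ρ, x]])
          (⋆ℂ[o x, h₁] ((Lform[G] β) x))) := by
    rw [lform_fun_smul]
    exact dolbeaultBarAdjoint_fun_smul_apply o ho h₁ h₂ hρ hLβ
  rw [lform_apply] at eA
  have eC := eq_add_of_sub_eq' (dolbeault_fun_smul_sub (x := x) hρ hβ)
  rw [← wedgeOne_tangentSpace x] at eC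
  have hS := symbol_identity_pt_zero o x hn (hH x) (G x) (hG x) (π₁₀[dρ[ρ, x]])
    (π₁₀_I_smul (dρ[ρ, x])) h₁ h₂ (β x)
  rw [Pi.sub_apply, Pi.smul_apply, Pi.sub_apply, Pi.smul_apply]
  exact kaehlerP_algebra_zero (ρ x) eA eC hS

end CinftyLinear

end Literature.NumberTheory.Transcendental
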